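import Literature.NumberTheory.FaltingsSerre.ParamodularTemplate
import HarnessLib

/-!
# The Faltings–Serre method after Brumer–Pacetti–Poor–Tornaría–Voight–Yuen, IX:
# the instance `N = 587`, Fricke sign `+` (certificate `certs/587/plus/certificate.canonical.json`, sha256 `9ac7f5381b505f82…`)

[BPPTVY] = A. Brumer, A. Pacetti, C. Poor, G. Tornaría, J. Voight, D. S. Yuen, *On the paramodularity of
typical abelian surfaces*, Algebra & Number Theory **13**:5 (2019) 1145–1195 [cite: BrumerEtAl2019].
[PY15] = C. Poor, D. S. Yuen, *Paramodular cusp forms*, Math. Comp. **84** (2015) 1401–1438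
[cite: PoorYuen2015]: Thm 1.1 / Thm 1.2 (p. 1402) and Table 5 (p. 1433) give, at the prime level `587`,
one weight-2 nonlift Hecke eigenform in EACH Fricke eigenspace, `f₅₈₇⁺` and `f₅₈₇⁻`, both with rational
eigenvalues, each `= Q/L` in Gritsenko lifts (files `QL-587plus.txt`, `QL-587minus.txt` of the authors'
website).  [BPPTVY, Thm 7.3.1] proves that `A⁻ = Jac(C⁻)`, `C⁻` = LMFDB `587.a.587.1`, is paramodular
with partner `f₅₈₇⁻` (residual image `S₆`).  THIS FILE concerns the OTHER pair, which is not treated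
in print: `A⁺ = Jac(C⁺)`, `C⁺ : y² + (x³+x+1)y = −x⁶+4x⁴+x³+2x²−14x+14` (the genus-2 curve `587.a2` of
the LMFDB alpha release `g2c_curves_new`, conductor `587`, root number `+1`), partner `f₅₈₇⁺`.

This file is the `N = 587`, sign `+` INSTANCE of the template `paramodular_of_surfaceCertificate`
(`ParamodularTemplate.lean`), in exactly the shape of `Paramodular349.lean` / `Paramodular353.lean`:
`A⁺` is paramodular of level `587` away from `587`, GIVEN (i) the cited Faltings–Serre criterion `hFS`
([BPPTVY, Thm 2.1.5]; discharged in `CriterionProofs.lean` by `traceEq_of_faltingsSerre_symplectic_holds`),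
(ii) the Arthur-dependent input `hρf` ([BPPTVY, Thm 4.3.4]), and (iii) the CERTIFICATE `Certificate587plus`
= `SurfaceCertificate 587 checkPrimes587plus`, a hypothesis discharged OUTSIDE THE KERNEL by the cell's
merged certificate `certs/587/plus/certificate.canonical.json`
(sha256 `9ac7f5381b505f82e7e8e9323eccada07156e3105b7cfaeb79e03dd40afb02f1`), every load-bearing datum by
two independent implementations: conductor `587` and Euler factors of `A⁺` (PARI `hyperellcharpoly` and
pure-Python point counts, plus two further seats at the check primes); `ℚ(A⁺[2]) = ℚ(A⁻[2])` with group
`S₆` and an explicit isomorphism `A⁺[2] ≃ A⁻[2]` of Galois modules (twice), so that the class-field /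
obstruction computation of the `587⁻` certificate (which depends only on `(ρ̄, S)`) applies verbatim and
yields BPPTVY's printed check primes `P(587) = {3,5,7,11,13,17,19,23,29,37,41}`; the Hecke eigenvalues
`λ_p(f₅₈₇⁺)`, `p ≤ 43`, by two code-disjoint evaluations of `Q/L` (and `b₃, b₁₁` by `T(p²)` / `T₁(p²)` on
two engines) — equal to `a_p(A⁺)` at every computed prime.  The method is [BPPTVY]'s; the level-`587`,
sign-`+` statement with this explicit curve and form is, as far as the cell's literature search found
(TARGETS.md Part D1), not in print.
-/

noncomputable section

namespace Literature.NumberTheory.FaltingsSerre.Paramodular587plus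

open Polynomial IsDedekindDomain
open Literature.NumberTheory.FaltingsSerre Literature.NumberTheory.GaloisRepresentations
  Literature.NumberTheory.Automorphic.Paramodular Literature.NumberTheory.Automorphic
  Literature.AlgebraicGeometry.Motives
open scoped NumberField

/-- The check primes `P(587)`: BPPTVY's printed set for level `587` ([BPPTVY, Thm 7.3.1]), re-derived twice
by the engineer-1 obstruction search on the class-field data of the degree-20 field `K₀` for image `S₆`
and transferred to the plus pair (same residual representation, same `S`):
`{3,5,7,11,13,17,19,23,29,37,41}`. [cite: BrumerEtAl2019, Thm 7.3.1 p. 1191 (printed set); Alg 2.4.1 p. 1156 (the algorithm producing such a set)] -/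
def checkPrimes587plus : Finset ℕ := {3, 5, 7, 11, 13, 17, 19, 23, 29, 37, 41}

/-- Data check: eleven check primes, `41` the largest, `31` and `43` absent. [folklore] -/
theorem checkPrimes587plus_card : checkPrimes587plus.card = 11 ∧ 41 ∈ checkPrimes587plus ∧
    31 ∉ checkPrimes587plus ∧ 43 ∉ checkPrimes587plus := by
  simp [checkPrimes587plus]

/-- **The `N = 587`, sign `+` certificate, as a hypothesis**: `SurfaceCertificate 587 checkPrimes587plus J ν ρA ρf`
(`ParamodularTemplate.lean`; fields `similitude₁₂`, `det_isUnit`, `transpose_eq`, `diag_eq`,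
`unramified₁₂`, `absIrreducible`, `residual_eq`, `complete`, `traces` of `Certificate`).  Discharged
OUTSIDE THE KERNEL by `certs/587/plus/certificate.canonical.json` (sha256 `9ac7f5381b505f82e7e8e9323eccada07156e3105b7cfaeb79e03dd40afb02f1`) — blocks:
`residual` (image `S₆ = Sp₄(𝔽₂)`: `ℚ(A⁺[2])` = splitting field of the 2-division sextic = LMFDB `6.2.37568.1`
= `ℚ(A⁻[2])`, with an explicit module isomorphism `A⁺[2] ≃ A⁻[2]` (twice: PARI `nfisisom` and exact
arithmetic); `ρ̄_f ≃ ρ̄_A` by the engineer-1 sieve for `(ρ̄, S)` with `Q₃(f₅₈₇⁺) ≡ 1+T²+T⁴`,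
`Q₁₁(f₅₈₇⁺) ≡ 1+T+T²+T³+T⁴ (mod 2)`, each coefficient by two recomputations, and independently by Route E
(étale-algebra sieve on `λ_p` parities); candidate fields from the LMFDB — completeness CITED),
`classfield`/`group_theory`/`obstructing` (the `587⁻` sub-certificate, cited by hash: `K₀` of degree 20,
`Cl_S(K₀) = 1` GRH-free twice, check primes = `checkPrimes587plus`), `trace_check`
(`a_p(A⁺) = λ_p(f₅₈₇⁺)` on `checkPrimes587plus`: `0,0,−2,1,0,−2,5,9,−3,0,5`, each side by two implementations). [cite: BrumerEtAl2019, Alg 2.4.1 p. 1156; Thm 2.1.5 p. 1150; §7.3 p. 1191] -/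
def Certificate587plus (J : Matrix (Fin 4) (Fin 4) ℤ_[2]) (ν : Field.absoluteGaloisGroup ℚ → ℤ_[2])
    (ρA ρf : FramedGaloisRep ℚ ℤ_[2] 4) : Prop :=
  SurfaceCertificate 587 checkPrimes587plus J ν ρA ρf

/-- **`A⁺ = Jac(C⁺)` is paramodular of level `587` away from `587`, with partner `f₅₈₇⁺`, from the
certificate.**  Binders exactly as in `paramodular_of_surfaceCertificate` with `N = 587`,
`T = checkPrimes587plus`; `h2` is the hand check `L_2(A⁺,T) = Q_2(f⁺,T) = 1+T+3T²+2T³+4T⁴`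
(`a_2 = −1`, `b_2 = 3` both sides; [PY15, Table 5]: `λ₂ = −1`, `λ₄ = −3`). [cite: BrumerEtAl2019, Thm 2.1.5 p. 1150; Thm 4.3.4 p. 1169; Alg 2.4.1 p. 1156; §7.3 p. 1191 (the minus pair)] -/
theorem paramodular_587plus (hFS : traceEq_of_faltingsSerre_symplectic)
    {A : AbelianVariety ℚ} {f : Matrix (Fin 2) (Fin 2) ℂ → ℂ}
    {ρA ρf : FramedGaloisRep ℚ ℤ_[2] 4} {J : Matrix (Fin 4) (Fin 4) ℤ_[2]}
    {ν : Field.absoluteGaloisGroup ℚ → ℤ_[2]}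
    {b : Module.Basis (Fin 4) ℚ_[2] (A.rationalTateModule 2)}
    (hC : Certificate587plus J ν ρA ρf)
    (hframe : A.IsFrameOfTateRep 2 b (rationalize ρA))
    (aA bA af bf : ℕ → ℤ)
    (hA : ∀ p : ℕ, p.Prime → ¬ p ∣ 587 →
      A.HasGoodEulerFactorAt p ((lPolynomialOfSurface p (aA p) (bA p)).map (Int.castRingHom ℚ)))
    (hρf : ∀ p : ℕ, p.Prime → ¬ p ∣ 587 → p ≠ 2 →
      ∀ v : HeightOneSpectrum (𝓞 ℚ), ((p : ℕ) : 𝓞 ℚ) ∈ v.asIdeal →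
        ρf.HasFrobCharpolyAt v
          ((lPolynomialOfSurface p (af p) (bf p)).reverse.map (Int.castRingHom ℤ_[2])))
    (hcusp : IsParamodularCuspForm 587 2 f) (hne : ∃ Z ∈ siegelUpperHalfSpace 2, f Z ≠ 0)
    (hfe : ∀ p : ℕ, p.Prime → ¬ p ∣ 587 →
      HasSpinorEulerFactorAt 2 p f ((lPolynomialOfSurface p (af p) (bf p)).map (Int.castRingHom ℂ)))
    (h2 : aA 2 = af 2 ∧ bA 2 = bf 2) :
    IsParamodularAwayFrom A 587 f :=
  paramodular_of_surfaceCertificate hFS hC hframe aA bA af bf hA hρf hcusp hne hfe (fun _ => h2)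

/-- The conclusion at one prime `p ≠ 587`: one polynomial is both `L_p(A⁺,T)` and `Q_p(f₅₈₇⁺,T)`. [cite: BrumerEtAl2019, Thm 7.3.1 p. 1191 (shape of the statement, minus pair)] -/
theorem eulerFactors_agree_587plus {A : AbelianVariety ℚ} {f : Matrix (Fin 2) (Fin 2) ℂ → ℂ}
    (h : IsParamodularAwayFrom A 587 f) {p : ℕ} (hp : p.Prime) (hpN : p ≠ 587) :
    ∃ Q : Polynomial ℚ, HasSpinorEulerFactorAt 2 p f (Q.map (algebraMap ℚ ℂ)) ∧
      A.HasGoodEulerFactorAt p Q :=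
  eulerFactors_agree_of_prime (by norm_num) h hp hpN

end Literature.NumberTheory.FaltingsSerre.Paramodular587plus

end
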